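import Summits.QuantumFields.BalabanUV.Beta.GAN24.TwoLevelDefectVanishing
import Summits.QuantumFields.BalabanUV.Beta.GAN24.PeriodicCubeFaceSums
import Summits.QuantumFields.BalabanUV.Beta.GAN24.TaylorBlockSum

/-!
# `BalabanUV.Beta.GAN24.PeriodicCubeDefectVanishing` — binder row G-an2-4 ∕ (CONV-C), the (S) row ∕ (W-γ) one level up, the β-CHAIN (levels ≥ 2), FILE F1b:
# **THE DEFECT (C2′) VANISHES AT EVERY DEPTH — `Σ'_w Σ_μ dψ_P(μ,w)·(BO − EI)_{Lc}(H_j n)(μ,w)·C(μ,w) = 0` whenever the slot factor is a `P`-COARSE GRADIENT `C = 𝒬ᵀ_P β`,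
# the datum `n` is bounded and `P`-PERIODIC, and the label is a `P`-CUBE `ψ_P = 1_{quo_P · = y}`** (`Lc` odd, centred root, every `j`, EVERY `P ≥ 1`, every summable `β`, every `y`);
# and the same read through (β): the constraint-Hessian sector against `(C, H_j n, d(ψ_P ∘ blk))` vanishes
# (G-an2-4 CRUX TEAM (2), seat `b2b-balaban-gan24-formalise-leaf-06` = the (γ) hand, gen 50, memo `LEVELS-GE2.md` §2–§3, file F1)

NOT IN PRINT; OUR BOOKKEEPING ([folklore] BY NAME over gen 49's chain with the modulus of the LABEL and of the DATA PERIOD generalised from `Lc` to `P`: leaf-06 g46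
`RelInvWardPairing.tsum_mul_contourSumAdj_bdd` (adjointness of `𝒬ᵀ_P`), (α) `BlockWeightContourCommutation` at block side `P`, (δ2b) `TwoLevelDefectVanishing` §1–§2 (crossing sums at
side `P`, uniform bounds), TODAY's F1a `PeriodicCubeFaceSums` (face sums of `EI`∕`BO` of `H_j n` over `P`-cube faces vanish for `P`-periodic `n`), (β)
`GaugeLegDefectsBlockConstant.constraintHessian_gaugeLeg_blockConstant`, an3's `TaylorBlockSum.summable_comp_quo`; 0 `def`, 0 cited fact, 0 `def … : Prop`, 0 sorry).
AT `P := Lc`, `C := C_j(colH G_{j+1}(e))`, `β := (stepScale_{j+1}∕wVH_{j+1})·colM G_{j+1}(e)` IT IS (δ2b) ((E3) supplies `hC`).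
HONEST FRAMING (cell contract, verbatim): «discharging `BetaPertH` makes Bałaban's UV stability UNCONDITIONAL — a real constructive-QFT result; it is NOT the continuum limit and NOT
the Clay problem.»  HONEST DEPENDENCY (verbatim): «continuum YM on T⁴ ⇐ BetaPertH ∧ nine spine estimates (0/9 proved); BetaPertH ⇐ (D1) ∧ (D4) ∧ CAP+tail; G-an2-4 gates asym,
D1 and NE2/3/4.»

WHY (memo `HOME/b2b-balaban-gan24-formalise-leaf-06/g50/LEVELS-GE2.md`).  The level recursion `CubicSectorLevelDown.cubicSector_SrecAt_eq_levelDown` evaluates the level-`k`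
closed form (`SourcePairingLevelOneGeneric` at the base) at DEPTH-`m` data `(h_k, n_k, ψ_k) = (H_{k+1} g, H_{k+1} n_{k+1}, ψ_{k+1} ∘ blk)`; its displayed defect is
`(C2′)_k(h_k; n_k; ψ_k) = Σ'_w Σ_μ (C_k h_k)(μ,w)·dψ_k(μ,w)·(BO − EI)_{Lc}(H_k n_k)(μ,w)`.  Along the tower: `C_k h_k = Π(stepScale∕wVH)·𝒬ᵀ_{P}(colM G_{j+1}(e))` with `P = Lc^{m+1}`
(`FieldResponseCoarseGradient.multResponse_fieldResponse_eq` iterated, `𝒬ᵀ_a ∘ 𝒬ᵀ_b = 𝒬ᵀ_{ab}`), `n_k` is `P`-periodic (`colH_translate`, one factor `Lc` per response), `ψ_k` is the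
indicator of a `P`-cube.  THIS FILE: under exactly these three abstract hypotheses the defect vanishes — adjointness moves `𝒬_P` onto `dψ_P⊙U`; the label is block-constant at side
`P`, so (α) at side `P` leaves the CROSSING-position sum `Σ_{b∈box P} U(μ, P•Y + b|_{b_μ := P−1})` = `P` copies of the exit-face sum of `U = (BO − EI)_{Lc}(H_j n)` over the `P`-cube
`Y` — zero by F1a for `P`-periodic `n`.  §2 reads the same through (β) for the Lagrange (constraint-Hessian) sector, whose closed form (`LambdaSectorSourcePairingZero`) carries the
same three objects.
* §1 **`periodicCube_defect_eq_zero`** — the statement in the title (`H_j n`, `EI`, `BO`, `dψ_P` INLINE in the letters of (α) ∕ (δ2a); `C` abstract with `hC : C = 𝒬ᵀ_P β`, `β κ` summable).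
* §2 **`constraintHessianSector_periodicCube_eq_zero`** — `Σ'_w Σ_μ C(μ,w)·Σ'_u Σ_κ (H_j n) κ u·(Σ'_x Σ_κ₂ hessFFAt ρ Lc μ w u x (inl κ)(inl κ₂)·dz (ψ_P ∘ blk) κ₂ x) = 0`.
Asserts NO value of any resolvent column beyond FILE F + (γ); the identification of the tower's `(C_k h_k, n_k, ψ_k)` with these hypotheses (F3) and the generic level-`j` closed form
(F2) are NOT here; NOTHING of `hX` at `j ≥ 1` ∕ (W-γ)_{≥2} ∕ (INV) ∕ (S) above level 1 discharged; NEVER «G-an2-4 closed» as (CONV-C); NOT D1, NOT `BetaPertH`, NOT continuum, NOT Clay.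
2026-08-23; no existing file touched.
-/

noncomputable section

open Finset
open scoped BigOperators
open Literature.MathematicalPhysics.QuantumFieldTheory
open Literature.MathematicalPhysics.QuantumFieldTheory.Balaban1983to89
open Literature.MathematicalPhysics.QuantumFieldTheory.Balaban1983to89.Beta
open B12Sec2to5 (l1 l1_nonneg)
open ExpKernelCalculus (Site MKer Decays Zl summable_exp_shift' tsum_exp_shift')
open AffineAveraging (Form1 box toSite unitVec unitVec_apply dz contourSum)
open AffineReproduction (contourSumAdj)
open AveragingContours (blk blk_block)
open AveragingContoursRooted (ctrOff ctrOff_mem_box)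
open LatticeForm (quo)
open KernelSpecInstance (wΦ)
open OneStepKernelFamily (KInvStep colH)
open SecondOrderResponse (colM)
open BalabanStepJetsSucc (wVH)
open AveragingHessianKernelsRooted (hessFFAt)
open Summit.QuantumFields.BalabanUV.Beta.AxialDressingRooted (IsCombBondAt coDressKBmAt decays_coDressKBmAt_KInvStep one_le_of_neZero spr_coDressKBmAt)
open Summit.QuantumFields.BalabanUV.Beta.BorderedHessian (stepScale stepScale_ne_zero spr_KInvStep)
open Summit.QuantumFields.BalabanUV.Beta.GAN24.RelInvWardPairing (tsum_mul_contourSumAdj_bdd summable_abs_comp_quo)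
open Summit.QuantumFields.BalabanUV.Beta.GAN24.DataColumnCombRows (E2row_colH_eq_contourSumAdj_colM_succ)
open Summit.QuantumFields.BalabanUV.Beta.GAN24.BlockWeightContourCommutation (contourSum_endWeight_mul contourSum_baseWeight_mul)
open Summit.QuantumFields.BalabanUV.Beta.GAN24.GaugeLegDefectsBlockConstant (constraintHessian_gaugeLeg_blockConstant)
open Summit.QuantumFields.BalabanUV.Beta.GAN24.BorderGaugeLegBlockPotential (colH_coDressKBmAt_eq_zero_of_isCombBond)
open Summit.QuantumFields.BalabanUV.Beta.GAN24.PeriodicDataFaceSums (summable_abs_source_colH periodic_faceSum_EI_eq_zero periodic_faceSum_BO_eq_zero)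
open Summit.QuantumFields.BalabanUV.Beta.GAN24.TwoLevelDefectVanishing (abs_tsum_colH_source_le sum_box_update_eq_sum_faceSum contourSum_sub_EI_sub_BO)
open Summit.QuantumFields.BalabanUV.Beta.GAN24.PeriodicCubeFaceSums (periodicCube_faceSum_EI_eq_zero periodicCube_faceSum_BO_eq_zero)
open Summit.QuantumFields.BalabanUV.Beta.GAN24.TaylorBlockSum (summable_comp_quo)

namespace Summit.QuantumFields.BalabanUV.Beta.GAN24.PeriodicCubeDefectVanishing

variable {d : ℕ} {Lc : ℕ} [NeZero Lc]

/-! ## §1 The defect vanishes for a `P`-coarse-gradient slot factor, `P`-periodic data and a `P`-cube label -/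

/-- NOT IN PRINT; OUR BOOKKEEPING.  **THE DEFECT (C2′) VANISHES AT EVERY DEPTH** (`Lc` odd, centred root `ρ = toSite (ctrOff (d+1) Lc)`, every level `j`, every `P ≥ 1`, every BOUNDED
`P`-PERIODIC datum `n`, every cube label `y`, every slot factor `C = 𝒬ᵀ_P β` with `β κ` summable):
`Σ'_w Σ_μ dψ_P(μ,w)·U(μ,w)·C(μ,w) = 0`, where (INLINE) `dψ_P(μ,w) = [quo_P(w+e_μ) = y] − [quo_P w = y]`, `U = (BO_{Lc} − EI_{Lc})(H_j n)` (FILE (α)'s letters),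
`H_j n μ u = Σ_l Σ'_t n l t·colH G_j Lc l t μ u`. -/
theorem periodicCube_defect_eq_zero (hLc : Odd Lc) (j : ℕ) {P : ℕ} [NeZero P] {n : Form1 (d + 1) ℝ} {Bn : ℝ} (hnB : ∀ l t, |n l t| ≤ Bn)
    (hper : ∀ (l : Fin (d + 1)) (t z : Site (d + 1)), n l (t + (P : ℤ) • z) = n l t) (y : Site (d + 1))
    {C β : Form1 (d + 1) ℝ} (hβs : ∀ κ, Summable (β κ)) (hC : ∀ μ w, C μ w = contourSumAdj P β μ w) :
    ∑' w : Site (d + 1), ∑ μ,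
      (((if blk P (w + unitVec μ) = y then (1 : ℝ) else 0) - (if blk P w = y then (1 : ℝ) else 0))
        * ((∑ b ∈ box (d + 1) Lc, ∑ s ∈ Finset.range Lc, (if Lc ≤ b μ + s then
              (∑ l, ∑' t : Site (d + 1), n l t * colH (coDressKBmAt (toSite (ctrOff (d + 1) Lc)) Lc (KInvStep (d := d) Lc j)) Lc l t μ
                ((Lc : ℤ) • w + toSite b + (s : ℤ) • unitVec μ)) else 0))
          - (∑ b ∈ box (d + 1) Lc, ∑ s ∈ Finset.range Lc, (if b μ + s + 1 < Lc then
              (∑ l, ∑' t : Site (d + 1), n l t * colH (coDressKBmAt (toSite (ctrOff (d + 1) Lc)) Lc (KInvStep (d := d) Lc j)) Lc l t μ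
                ((Lc : ℤ) • w + toSite b + (s : ℤ) • unitVec μ)) else 0)))
        * C μ w) = 0 := by
  classical
  have hLc1 : 1 ≤ Lc := one_le_of_neZero Lc
  have hP1 : 1 ≤ P := one_le_of_neZero P
  set G := coDressKBmAt (toSite (ctrOff (d + 1) Lc)) Lc (KInvStep (d := d) Lc j) with hGdef
  -- the inline objects as functions
  set Hn : Form1 (d + 1) ℝ := fun μ u => ∑ l, ∑' t : Site (d + 1), n l t * colH G Lc l t μ u with hHn
  set U : Form1 (d + 1) ℝ := fun μ w =>
    (∑ b ∈ box (d + 1) Lc, ∑ s ∈ Finset.range Lc, (if Lc ≤ b μ + s then Hn μ ((Lc : ℤ) • w + toSite b + (s : ℤ) • unitVec μ) else 0))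
      - (∑ b ∈ box (d + 1) Lc, ∑ s ∈ Finset.range Lc, (if b μ + s + 1 < Lc then Hn μ ((Lc : ℤ) • w + toSite b + (s : ℤ) • unitVec μ) else 0)) with hU
  set dψ : Form1 (d + 1) ℝ := fun μ w => (if blk P (w + unitVec μ) = y then (1 : ℝ) else 0) - (if blk P w = y then (1 : ℝ) else 0) with hdψ
  show ∑' w : Site (d + 1), ∑ μ, dψ μ w * U μ w * C μ w = 0
  -- bounds: `dψ·U` is bounded
  obtain ⟨CH, hCH0, hCH⟩ := abs_tsum_colH_source_le (d := d) (Lc := Lc) j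
  have hBn : 0 ≤ Bn := (abs_nonneg _).trans (hnB 0 0)
  have hHnb : ∀ μ u, |Hn μ u| ≤ ((d : ℝ) + 1) * (Bn * CH) := by
    intro μ u
    simp only [hHn]
    refine (Finset.abs_sum_le_sum_abs _ _).trans ?_
    have hterm : ∀ l, |∑' t : Site (d + 1), n l t * colH G Lc l t μ u| ≤ Bn * CH := by
      intro l
      have hs : Summable fun t : Site (d + 1) => |n l t * colH G Lc l t μ u| := by
        refine Summable.of_nonneg_of_le (fun _ => abs_nonneg _) (fun t => ?_) ((summable_abs_source_colH (Lc := Lc) j l μ u).mul_left Bn)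
        rw [abs_mul]; exact mul_le_mul_of_nonneg_right (hnB l t) (abs_nonneg _)
      have h1 : |∑' t : Site (d + 1), n l t * colH G Lc l t μ u| ≤ ∑' t : Site (d + 1), |n l t * colH G Lc l t μ u| := by
        have := norm_tsum_le_tsum_norm (f := fun t : Site (d + 1) => n l t * colH G Lc l t μ u) (by simpa only [Real.norm_eq_abs] using hs)
        simpa only [Real.norm_eq_abs] using this
      refine h1.trans ?_
      calc ∑' t : Site (d + 1), |n l t * colH G Lc l t μ u| ≤ ∑' t : Site (d + 1), Bn * |colH G Lc l t μ u| :=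
            hs.tsum_le_tsum (fun t => by rw [abs_mul]; exact mul_le_mul_of_nonneg_right (hnB l t) (abs_nonneg _))
              ((summable_abs_source_colH (Lc := Lc) j l μ u).mul_left Bn)
        _ = Bn * ∑' t : Site (d + 1), |colH G Lc l t μ u| := tsum_mul_left
        _ ≤ Bn * CH := mul_le_mul_of_nonneg_left (hCH l μ u) hBn
    calc ∑ l, |∑' t : Site (d + 1), n l t * colH G Lc l t μ u| ≤ ∑ _l : Fin (d + 1), Bn * CH := Finset.sum_le_sum fun l _ => hterm l
      _ = ((d : ℝ) + 1) * (Bn * CH) := by rw [Finset.sum_const, Finset.card_univ, Fintype.card_fin, nsmul_eq_mul]; push_cast; ring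
  set BH : ℝ := ((d : ℝ) + 1) * (Bn * CH) with hBH
  have hBH0 : 0 ≤ BH := by rw [hBH]; positivity
  have hpart : ∀ (Q : (Fin (d + 1) → ℕ) → ℕ → Prop) [∀ b s, Decidable (Q b s)] (μ : Fin (d + 1)) (w : Site (d + 1)),
      |∑ b ∈ box (d + 1) Lc, ∑ s ∈ Finset.range Lc, (if Q b s then Hn μ ((Lc : ℤ) • w + toSite b + (s : ℤ) • unitVec μ) else 0)|
        ≤ ((box (d + 1) Lc).card : ℝ) * ((Lc : ℝ) * BH) := by
    intro Q _ μ w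
    refine (Finset.abs_sum_le_sum_abs _ _).trans ?_
    calc ∑ b ∈ box (d + 1) Lc, |∑ s ∈ Finset.range Lc, (if Q b s then Hn μ ((Lc : ℤ) • w + toSite b + (s : ℤ) • unitVec μ) else 0)|
        ≤ ∑ _b ∈ box (d + 1) Lc, (Lc : ℝ) * BH := Finset.sum_le_sum fun b _ => by
          refine (Finset.abs_sum_le_sum_abs _ _).trans ?_
          calc ∑ s ∈ Finset.range Lc, |(if Q b s then Hn μ ((Lc : ℤ) • w + toSite b + (s : ℤ) • unitVec μ) else 0)|
              ≤ ∑ _s ∈ Finset.range Lc, BH := Finset.sum_le_sum fun s _ => by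
                split_ifs
                · exact hHnb _ _
                · rw [abs_zero]; exact hBH0
            _ = (Lc : ℝ) * BH := by rw [Finset.sum_const, Finset.card_range, nsmul_eq_mul]
      _ = ((box (d + 1) Lc).card : ℝ) * ((Lc : ℝ) * BH) := by rw [Finset.sum_const, nsmul_eq_mul]
  have hUb : ∀ μ w, |U μ w| ≤ 2 * (((box (d + 1) Lc).card : ℝ) * ((Lc : ℝ) * BH)) := by
    intro μ w
    simp only [hU]
    refine (abs_sub _ _).trans ?_
    have h1 := hpart (fun b s => Lc ≤ b μ + s) μ w
    have h2 := hpart (fun b s => b μ + s + 1 < Lc) μ w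
    linarith
  have hdψb : ∀ μ w, |dψ μ w| ≤ 2 := by
    intro μ w
    simp only [hdψ]
    refine (abs_sub _ _).trans ?_
    have : ∀ (Q : Prop) [Decidable Q], |(if Q then (1 : ℝ) else 0)| ≤ 1 := fun Q _ => by split <;> simp
    linarith [this (blk P (w + unitVec μ) = y), this (blk P w = y)]
  have hm : ∀ μ w, |dψ μ w * U μ w| ≤ 2 * (2 * (((box (d + 1) Lc).card : ℝ) * ((Lc : ℝ) * BH))) := by
    intro μ w
    rw [abs_mul]
    exact mul_le_mul (hdψb μ w) (hUb μ w) (abs_nonneg _) (by norm_num)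
  -- summability of `β ∘ quo_P`
  have hφ : ∀ κ, Summable fun u : Site (d + 1) => |β κ (quo P u)| := fun κ => (summable_comp_quo (N := P) (hβs κ)).abs
  -- the main chain
  have step1 : (∑' w : Site (d + 1), ∑ μ, dψ μ w * U μ w * C μ w)
      = ∑' w : Site (d + 1), ∑ μ, (dψ μ w * U μ w) * contourSumAdj P β μ w := by
    refine tsum_congr fun w => Finset.sum_congr rfl fun μ _ => ?_
    rw [hC μ w]
  have step2 : (∑' w : Site (d + 1), ∑ μ, (dψ μ w * U μ w) * contourSumAdj P β μ w)
      = ∑' Y : Site (d + 1), ∑ μ, β μ Y * contourSum P (fun μ w => dψ μ w * U μ w) μ Y :=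
    tsum_mul_contourSumAdj_bdd (N := P) (m := fun μ w => dψ μ w * U μ w) hm hφ
  -- per `P`-cube bond: the side-`P` contour sum of `dψ_P⊙U` is the crossing-position sum, a sum of vanishing `P`-cube face sums
  have step3 : ∀ μ Y, contourSum P (fun μ w => dψ μ w * U μ w) μ Y = 0 := by
    intro μ Y
    set ψb : Site (d + 1) → ℝ := fun Z => if Z = y then 1 else 0 with hψb
    have esplit : (fun μ (w : Site (d + 1)) => dψ μ w * U μ w)
        = (fun μ w => ψb (blk P (w + unitVec μ)) * U μ w) - (fun μ w => ψb (blk P w) * U μ w) := by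
      funext μ w; simp only [hdψ, hψb, Pi.sub_apply]; ring
    have hsub : ∀ (A B : Form1 (d + 1) ℝ), contourSum P (A - B) μ Y = contourSum P A μ Y - contourSum P B μ Y := fun A B => by
      simp only [AffineAveraging.contourSum, Pi.sub_apply, Finset.sum_sub_distrib]
    rw [esplit, hsub, contourSum_endWeight_mul hP1 ψb U μ Y, contourSum_baseWeight_mul hP1 ψb U μ Y]
    have ecr := contourSum_sub_EI_sub_BO (d := d) (Lc := P) U μ Y
    have eface : ∑ b ∈ box (d + 1) P, U μ ((P : ℤ) • Y + toSite (Function.update b μ (P - 1))) = 0 := by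
      rw [sum_box_update_eq_sum_faceSum (Lc := P) μ (fun r => U μ ((P : ℤ) • Y + toSite r))]
      refine Finset.sum_eq_zero fun c _ => ?_
      have hBO := periodicCube_faceSum_BO_eq_zero (d := d) hLc j hnB hper μ Y (P - 1)
      have hEI := periodicCube_faceSum_EI_eq_zero (d := d) hLc j hnB hper μ Y (P - 1)
      simp only [hU, hHn, Finset.sum_sub_distrib]
      rw [hBO, hEI, sub_self]
    have key : contourSum P U μ Y
        - (∑ b ∈ box (d + 1) P, ∑ s ∈ Finset.range P, (if b μ + s + 1 < P then U μ ((P : ℤ) • Y + toSite b + (s : ℤ) • unitVec μ) else 0))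
        - (∑ b ∈ box (d + 1) P, ∑ s ∈ Finset.range P, (if P ≤ b μ + s then U μ ((P : ℤ) • Y + toSite b + (s : ℤ) • unitVec μ) else 0)) = 0 := by
      rw [ecr, eface]
    simp only [AffineAveraging.dz]
    linear_combination (ψb (Y + unitVec μ) - ψb Y) * key
  have step4 : (∑' Y : Site (d + 1), ∑ μ, β μ Y * contourSum P (fun μ w => dψ μ w * U μ w) μ Y) = 0 := by
    simp [step3]
  rw [step1, step2, step4]

/-! ## §2 The constraint-Hessian sector against `(C, H_j n, d(ψ_P ∘ blk))` -/

/-- NOT IN PRINT; OUR BOOKKEEPING.  **THE CONSTRAINT-HESSIAN (LAGRANGE) SECTOR VANISHES AT EVERY DEPTH** (same hypotheses as §1): by (β)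
`GaugeLegDefectsBlockConstant.constraintHessian_gaugeLeg_blockConstant` the `hessFFAt` table against the block-constant pure gauge `d(ψ_P ∘ blk_{Lc})` and the comb-free leg `H_j n`
is `−(2Lc^{d+1})⁻¹·dψ_P·(BO_{Lc} − EI_{Lc})(H_j n)` slot by slot, so its pairing with `C = 𝒬ᵀ_P β` over the constraint slots `(μ, w)` is `−(2Lc^{d+1})⁻¹·(C2′) = 0` (§1):
`Σ'_w Σ_μ C(μ,w)·Σ'_u Σ_κ (H_j n) κ u·(Σ'_x Σ_κ₂ hessFFAt ρ Lc μ w u x (inl κ)(inl κ₂)·dz (fun z ↦ [quo_P (blk_{Lc} z) = y]) κ₂ x) = 0`. -/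
theorem constraintHessianSector_periodicCube_eq_zero (hLc : Odd Lc) (j : ℕ) {P : ℕ} [NeZero P] {n : Form1 (d + 1) ℝ} {Bn : ℝ} (hnB : ∀ l t, |n l t| ≤ Bn)
    (hper : ∀ (l : Fin (d + 1)) (t z : Site (d + 1)), n l (t + (P : ℤ) • z) = n l t) (y : Site (d + 1))
    {C β : Form1 (d + 1) ℝ} (hβs : ∀ κ, Summable (β κ)) (hC : ∀ μ w, C μ w = contourSumAdj P β μ w) :
    ∑' w : Site (d + 1), ∑ μ,
      C μ w
        * (∑' u : Site (d + 1), ∑ κ,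
            (∑ l, ∑' t : Site (d + 1), n l t * colH (coDressKBmAt (toSite (ctrOff (d + 1) Lc)) Lc (KInvStep (d := d) Lc j)) Lc l t κ u)
              * (∑' x : Site (d + 1), ∑ κ₂, hessFFAt (toSite (ctrOff (d + 1) Lc)) Lc μ w u x (Sum.inl κ) (Sum.inl κ₂)
                  * dz (fun z => if blk P (blk Lc z) = y then (1 : ℝ) else 0) κ₂ x)) = 0 := by
  classical
  have hLc1 : 1 ≤ Lc := one_le_of_neZero Lc
  have hr := ctrOff_mem_box (d := d + 1) hLc1
  have hmain := periodicCube_defect_eq_zero (d := d) hLc j hnB hper y hβs hC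
  set G := coDressKBmAt (toSite (ctrOff (d + 1) Lc)) Lc (KInvStep (d := d) Lc j) with hGdef
  set Hn : Form1 (d + 1) ℝ := fun κ u => ∑ l, ∑' t : Site (d + 1), n l t * colH G Lc l t κ u with hHn
  set U : Form1 (d + 1) ℝ := fun μ w =>
    (∑ b ∈ box (d + 1) Lc, ∑ s ∈ Finset.range Lc, (if Lc ≤ b μ + s then Hn μ ((Lc : ℤ) • w + toSite b + (s : ℤ) • unitVec μ) else 0))
      - (∑ b ∈ box (d + 1) Lc, ∑ s ∈ Finset.range Lc, (if b μ + s + 1 < Lc then Hn μ ((Lc : ℤ) • w + toSite b + (s : ℤ) • unitVec μ) else 0)) with hU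
  set dψ : Form1 (d + 1) ℝ := fun μ w => (if blk P (w + unitVec μ) = y then (1 : ℝ) else 0) - (if blk P w = y then (1 : ℝ) else 0) with hdψ
  replace hmain : ∑' w : Site (d + 1), ∑ μ, dψ μ w * U μ w * C μ w = 0 := hmain
  show ∑' w : Site (d + 1), ∑ μ, C μ w * (∑' u : Site (d + 1), ∑ κ, Hn κ u
      * (∑' x : Site (d + 1), ∑ κ₂, hessFFAt (toSite (ctrOff (d + 1) Lc)) Lc μ w u x (Sum.inl κ) (Sum.inl κ₂)
          * dz (fun z => if blk P (blk Lc z) = y then (1 : ℝ) else 0) κ₂ x)) = 0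
  -- `H_j n` is comb-free
  have ha : ∀ κ u, IsCombBondAt (toSite (ctrOff (d + 1) Lc)) Lc κ u → Hn κ u = 0 := by
    intro κ u hc
    simp only [hHn]
    refine Finset.sum_eq_zero fun l _ => ?_
    have h0 : ∀ t : Site (d + 1), n l t * colH G Lc l t κ u = 0 := fun t => by
      rw [hGdef, colH_coDressKBmAt_eq_zero_of_isCombBond (toSite (ctrOff (d + 1) Lc)) (KInvStep (d := d) Lc j) l t hc, mul_zero]
    simp only [h0, tsum_zero]
  -- (β): the constraint-Hessian table slot by slot, block-constant gauge `ψ_P ∘ blk`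
  have hβ' : ∀ μ w, (∑' u : Site (d + 1), ∑ κ, Hn κ u
        * (∑' x : Site (d + 1), ∑ κ₂, hessFFAt (toSite (ctrOff (d + 1) Lc)) Lc μ w u x (Sum.inl κ) (Sum.inl κ₂)
            * dz (fun z => if blk P (blk Lc z) = y then (1 : ℝ) else 0) κ₂ x))
      = -((2 * (Lc : ℝ) ^ (d + 1))⁻¹ * (dψ μ w * U μ w)) := fun μ w => by
    have := constraintHessian_gaugeLeg_blockConstant (d := d) hLc1 hr μ w ha (fun w => if blk P w = y then (1 : ℝ) else 0)
    simpa only [AffineAveraging.dz, hdψ, hU] using this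
  have e1 : (∑' w : Site (d + 1), ∑ μ, C μ w * (∑' u : Site (d + 1), ∑ κ, Hn κ u
        * (∑' x : Site (d + 1), ∑ κ₂, hessFFAt (toSite (ctrOff (d + 1) Lc)) Lc μ w u x (Sum.inl κ) (Sum.inl κ₂)
            * dz (fun z => if blk P (blk Lc z) = y then (1 : ℝ) else 0) κ₂ x)))
      = -((2 * (Lc : ℝ) ^ (d + 1))⁻¹) * ∑' w : Site (d + 1), ∑ μ, dψ μ w * U μ w * C μ w := by
    rw [← tsum_mul_left]
    refine tsum_congr fun w => ?_
    rw [Finset.mul_sum]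
    refine Finset.sum_congr rfl fun μ _ => ?_
    rw [hβ' μ w]; ring
  rw [e1, hmain, mul_zero]

end Summit.QuantumFields.BalabanUV.Beta.GAN24.PeriodicCubeDefectVanishing

end
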